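import Literature.AlgebraicGeometry.HodgeTheory.WeilFamilyIsotropyBrackets
import Literature.AlgebraicGeometry.HodgeTheory.WeilFamilyInvariantFormsAllDegrees
import HarnessLib

/-!
# Weil's family, IV: the forms on `U = P × P` annihilated by the tangent space `𝔭` of `H_n` span at most a line in
# every degree `k ≠ 2n` and at most `3` dimensions in degree `2n` (van Geemen 1994, Thm. 6.12, infinitesimal form)

Layer `Literature/AlgebraicGeometry/HodgeTheory`, namespace `Literature.AlgebraicGeometry.HodgeTheory.WeilFamily`; lane
`lit-hodgefound` (Track 2 foundations library, Layer A4), seat `lit-hodgefound-skel-4`, programme row **A4-81** of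
`run/shared/lean/pub/lit-hodgefound/SKELETON.md` (§A4-DETAIL), FILE B2 = the INSTANTIATION of FILE B1
(`WeilFamilyInvariantFormsAllDegrees`: the torus/swap invariant bound for a complex dual pair) on FILE A's carrier
(`WeilFamilyIsotropyBrackets`: `U = P × P`, the tangent operators `pOp B = T_B`, the brackets `[𝔭,𝔭] ⊆ 𝔨` producing the
diagonal phases `adAlt_kOp_diagPhase_eq_zero` and the rotations `adAlt_kOp_rot_fst/snd_eq_zero`, the dual pair
`weilFrame b` / `weilVec b`).  Consumed BY NAME; nothing is restated.

## Source (held `book:green1994-algebraic-cycles-hodge-theory-lectures-given-at`, pp. 0231–0233)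

van Geemen, proof of Thm. 6.11: «`h(S¹) ⊂ G'(ℝ) ⟺ J' ∈ Lie(G')_ℝ` […] `H_n = {gJ'g⁻¹ : g ∈ SU_H(ℝ)}`»; Thm. 6.12:
«assume that `Hg(X) = SU_H` […] Then `dim B^p(X) = 1` for `p ≠ n`; `dim B^n(X) = 3`». Infinitesimally at the base
point `V_+ = P ⊕ 0` of `H_n`: a `k`-form on `U_ℝ` that is annihilated by `ad(T_B)` for every tangent direction
`T_B = (0 B†; B 0)` is annihilated by the whole Lie algebra these generate (FILE A: the trace-zero diagonal phases and
the rotations of `𝔰(𝔲(n) ⊕ 𝔲(n))`, i.e. together with `𝔭` all of `𝔰𝔲(n,n)`), hence (FILE B1) lies in a space of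
dimension `≤ 1` (`k ≠ 2n`), `≤ 3` (`k = 2n`), `0` (`k` odd).

## What is here

* `tangentAnnihilator k` — the complex subspace `{γ ∈ Alt^k_ℝ(U; ℂ) : ad(T_B) γ = 0 ∀ B}`;
* the dual-pair identities `weilFrame_weilVec` (`z_s(f_t) = δ_st`), the torus witnesses `exists_torus_of_sum_eq_zero`
  (for `θ : ι ⊕ ι → ℝ`, `Σ θ = 0`: `diag(Σ iθ_{inl c} E_cc, Σ iθ_{inr c} E_cc)` scales `f_s` by `iθ_s` and kills the
  annihilator) and the swap witnesses `exists_swap` (in-block rotations `E_cd − E_dc`, `u = −1`; cross-block tangent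
  operators `T_{E_ad}`, `u = 1`);
* **`finrank_tangentAnnihilator_le_one`** (`k ≠ 2 dim P`), **`finrank_tangentAnnihilator_le_three`**,
  **`tangentAnnihilator_eq_bot_of_odd`** — with the auxiliary orthonormal basis eliminated (`stdOrthonormalBasis`).

No named fact (D-0026); one definition with body (`tangentAnnihilator`).

## Not here

FILE C: the identification of `B^p` of the general member of the Siegel-coordinate families `𝖧_{A_d}` with a subspace
of (the rational points of) `tangentAnnihilator 2p` (p17's infinitesimal criterion along the family + Baire), and the
lower bound `E^{∧p} ≠ 0`, the Weil–Hodge classes in degree `2n`.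

## References

* [vanGeemen1994HodgeAV] B. van Geemen, LNM 1594 (1994), Lemma 5.10, Thm. 6.11, Thm. 6.12 and proofs.
* [Lange2023AbelianVarietiesComplex] H. Lange, *Abelian Varieties over the Complex Numbers* (2023), §7.2.4 Ex. (10).
-/

noncomputable section

open Function Finset Complex Module
open scoped InnerProductSpace ComplexConjugate

namespace Literature.AlgebraicGeometry.HodgeTheory

namespace WeilFamily

open Literature.LinearAlgebra.Alternating Literature.Analysis.Complex

variable {P : Type*} [NormedAddCommGroup P] [InnerProductSpace ℂ P] [FiniteDimensional ℂ P]

/-! ## §1 The annihilator of the tangent space -/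

/-- **The tangent annihilator** in degree `k`: the complex subspace of real `k`-forms on `U = P × P` with complex values
killed by `ad(T_B)` for every tangent direction `T_B = (0 B†; B 0)` of `H_n` at its base point («`J' ∈ Lie(G')_ℝ`»,
differentiated along `H_n = {gJ'g⁻¹}`). [cite: vanGeemen1994HodgeAV, proof of Thm. 6.11 and Thm. 6.12] -/
def tangentAnnihilator (k : ℕ) : Submodule ℂ ((P × P) [⋀^Fin k]→L[ℝ] ℂ) where
  carrier := {γ | ∀ B : P →ₗ[ℂ] P, adAlt (toRealCLM (pOp B)) γ = 0}
  add_mem' := by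
    intro γ γ' hγ hγ' B
    rw [map_add, hγ B, hγ' B, add_zero]
  zero_mem' := fun B ↦ map_zero _
  smul_mem' := by
    intro c γ hγ B
    simp only [Set.mem_setOf_eq] at hγ ⊢
    rw [adAlt_smul_right, hγ B, smul_zero]

/-- Membership in the tangent annihilator. [cite: vanGeemen1994HodgeAV, proof of Thm. 6.11 and Thm. 6.12] -/
theorem mem_tangentAnnihilator_iff {k : ℕ} (γ : (P × P) [⋀^Fin k]→L[ℝ] ℂ) :
    γ ∈ tangentAnnihilator k ↔ ∀ B : P →ₗ[ℂ] P, adAlt (toRealCLM (pOp B)) γ = 0 := Iff.rfl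

/-! ## §2 The dual pair of an orthonormal basis and the torus / swap witnesses -/

section Witnesses

variable {ι : Type*} [Fintype ι] [DecidableEq ι] (b : OrthonormalBasis ι ℂ P)

omit [FiniteDimensional ℂ P] in
/-- **`(weilFrame b, weilVec b)` is a complex dual pair**: `z_s(f_t) = δ_st`. [cite: vanGeemen1994HodgeAV, proof of Lemma 5.10 (orthonormal bases of `V_+`, `V_-`)] -/
theorem weilFrame_weilVec (s t : ι ⊕ ι) : weilFrame b s (weilVec b t) = if s = t then (1 : ℂ) else 0 := by
  rcases s with c | c <;> rcases t with d | d <;>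
    simp [weilFrame_inl_apply, weilFrame_inr_apply, weilVec_inl, weilVec_inr, inner_basis_eq_ite]

omit [FiniteDimensional ℂ P] in
/-- A diagonal operator `Σ_a x_a E_aa` scales the basis vectors: `(Σ_a x_a E_aa) b_c = x_c b_c`.
[cite: vanGeemen1994HodgeAV, proof of Thm. 6.12 (the diagonal torus)] -/
theorem sum_smul_munit_apply_basis (x : ι → ℂ) (c : ι) : (∑ a, x a • munit b a a) (b c) = x c • b c := by
  simp only [LinearMap.coe_sum, Finset.sum_apply, LinearMap.smul_apply, munit_apply, inner_basis_eq_ite, ite_smul,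
    one_smul, zero_smul, smul_ite, smul_zero, Finset.sum_ite_eq', Finset.mem_univ, if_true]

omit [FiniteDimensional ℂ P] in
/-- `E_cd b_e = δ_de b_c`. [cite: vanGeemen1994HodgeAV, proof of Lemma 5.10] -/
theorem munit_apply_basis (c d e : ι) : munit b c d (b e) = if d = e then b c else 0 := by
  rw [munit_apply, inner_basis_eq_ite, ite_smul, one_smul, zero_smul]

/-- **Torus witnesses**: for `θ : ι ⊕ ι → ℝ` with `Σ θ = 0`, the trace-zero diagonal phase
`D = diag(Σ iθ_{inl c} E_cc, Σ iθ_{inr c} E_cc)` satisfies `D f_s = iθ_s f_s` and kills the tangent annihilator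
(FILE A `adAlt_kOp_diagPhase_eq_zero`). [cite: vanGeemen1994HodgeAV, Lemma 5.10 and proof of Thm. 6.12] -/
theorem exists_torus_of_sum_eq_zero (k : ℕ) (θ : ι ⊕ ι → ℝ) (hθ : ∑ s, θ s = 0) :
    ∃ T : (P × P) →ₗ[ℂ] (P × P), (∀ s, T (weilVec b s) = ((θ s : ℂ) * I) • weilVec b s) ∧
      ∀ γ ∈ tangentAnnihilator (P := P) k, adAlt (realCLM T) γ = 0 := by
  refine ⟨kOp (∑ c, ((θ (Sum.inl c) : ℂ) * I) • munit b c c) (∑ c, ((θ (Sum.inr c) : ℂ) * I) • munit b c c),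
    ?_, fun γ hγ ↦ ?_⟩
  · rintro (c | c)
    · rw [weilVec_inl, kOp_apply, sum_smul_munit_apply_basis, map_zero, Prod.smul_mk, smul_zero]
    · rw [weilVec_inr, kOp_apply, sum_smul_munit_apply_basis, map_zero, Prod.smul_mk, smul_zero]
  · have hθ' : ∑ c, θ (Sum.inl c) + ∑ c, θ (Sum.inr c) = 0 := by rwa [Fintype.sum_sum_type] at hθ
    exact adAlt_kOp_diagPhase_eq_zero b hγ (fun c ↦ θ (Sum.inl c)) (fun c ↦ θ (Sum.inr c)) hθ'

/-- **Swap witnesses**: for `s ≠ t` in `ι ⊕ ι` a `ℂ`-linear operator killing the tangent annihilator with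
`X f_t = f_s`, `X f_s = u f_t`, `X f_r = 0` otherwise — in-block: the rotation `diag(E_cd − E_dc, 0)` or
`diag(0, E_cd − E_dc)` (`u = −1`, FILE A `adAlt_kOp_rot_fst/snd_eq_zero`); cross-block: the tangent operator `T_{E_ad}`
itself (`u = 1`). [cite: vanGeemen1994HodgeAV, Lemma 5.10, proof of Thm. 6.11 and of Thm. 6.12 (root vectors)] -/
theorem exists_swap (k : ℕ) (s t : ι ⊕ ι) (hst : s ≠ t) :
    ∃ T : (P × P) →ₗ[ℂ] (P × P), ∃ u : ℝ, u ≠ 0 ∧ T (weilVec b t) = weilVec b s ∧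
      T (weilVec b s) = (u : ℂ) • weilVec b t ∧ (∀ r, r ≠ s → r ≠ t → T (weilVec b r) = 0) ∧
      ∀ γ ∈ tangentAnnihilator (P := P) k, adAlt (realCLM T) γ = 0 := by
  rcases s with c | c <;> rcases t with d | d
  · -- in-block, first block: rotation
    have hcd : c ≠ d := fun h ↦ hst (by rw [h])
    refine ⟨kOp (munit b c d - munit b d c) 0, -1, by norm_num, ?_, ?_, ?_, fun γ hγ ↦ ?_⟩
    · rw [weilVec_inl, weilVec_inl, kOp_apply, LinearMap.sub_apply, munit_apply_basis, munit_apply_basis, if_pos rfl,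
        if_neg hcd, sub_zero, LinearMap.zero_apply]
    · rw [weilVec_inl, weilVec_inl, kOp_apply, LinearMap.sub_apply, munit_apply_basis, munit_apply_basis,
        if_neg (Ne.symm hcd), if_pos rfl, zero_sub, LinearMap.zero_apply, Prod.smul_mk, smul_zero]
      rw [Complex.ofReal_neg, Complex.ofReal_one, neg_one_smul]
    · rintro (e | e) hes het
      · have hce : c ≠ e := fun h ↦ hes (by rw [h])
        have hde : d ≠ e := fun h ↦ het (by rw [h])
        rw [weilVec_inl, kOp_apply, LinearMap.sub_apply, munit_apply_basis, munit_apply_basis, if_neg hde,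
          if_neg hce, sub_zero, LinearMap.zero_apply, Prod.mk_zero_zero]
      · rw [weilVec_inr, kOp_apply, map_zero, LinearMap.zero_apply, Prod.mk_zero_zero]
    · exact adAlt_kOp_rot_fst_eq_zero b hγ c d
  · -- cross-block `(inl c, inr d)`: the tangent operator `T_{E_dc}`
    refine ⟨pOp (munit b d c), 1, one_ne_zero, ?_, ?_, ?_, fun γ hγ ↦ ?_⟩
    · rw [weilVec_inr, weilVec_inl, pOp_apply, adjoint_munit, munit_apply_basis, if_pos rfl, map_zero]
    · rw [weilVec_inl, weilVec_inr, pOp_apply, map_zero, munit_apply_basis, if_pos rfl]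
      rw [Complex.ofReal_one, one_smul]
    · rintro (e | e) hes het
      · have hce : c ≠ e := fun h ↦ hes (by rw [h])
        rw [weilVec_inl, pOp_apply, map_zero, munit_apply_basis, if_neg hce, Prod.mk_zero_zero]
      · have hde : d ≠ e := fun h ↦ het (by rw [h])
        rw [weilVec_inr, pOp_apply, adjoint_munit, munit_apply_basis, if_neg hde, map_zero, Prod.mk_zero_zero]
    · exact hγ (munit b d c)
  · -- cross-block `(inr c, inl d)`: the tangent operator `T_{E_cd}`
    refine ⟨pOp (munit b c d), 1, one_ne_zero, ?_, ?_, ?_, fun γ hγ ↦ ?_⟩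
    · rw [weilVec_inl, weilVec_inr, pOp_apply, map_zero, munit_apply_basis, if_pos rfl]
    · rw [weilVec_inr, weilVec_inl, pOp_apply, adjoint_munit, munit_apply_basis, if_pos rfl, map_zero]
      rw [Complex.ofReal_one, one_smul]
    · rintro (e | e) hes het
      · have hde : d ≠ e := fun h ↦ het (by rw [h])
        rw [weilVec_inl, pOp_apply, map_zero, munit_apply_basis, if_neg hde, Prod.mk_zero_zero]
      · have hce : c ≠ e := fun h ↦ hes (by rw [h])
        rw [weilVec_inr, pOp_apply, adjoint_munit, munit_apply_basis, if_neg hce, map_zero, Prod.mk_zero_zero]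
    · exact hγ (munit b c d)
  · -- in-block, second block: rotation
    have hcd : c ≠ d := fun h ↦ hst (by rw [h])
    refine ⟨kOp 0 (munit b c d - munit b d c), -1, by norm_num, ?_, ?_, ?_, fun γ hγ ↦ ?_⟩
    · rw [weilVec_inr, weilVec_inr, kOp_apply, LinearMap.sub_apply, munit_apply_basis, munit_apply_basis, if_pos rfl,
        if_neg hcd, sub_zero, LinearMap.zero_apply]
    · rw [weilVec_inr, weilVec_inr, kOp_apply, LinearMap.sub_apply, munit_apply_basis, munit_apply_basis,
        if_neg (Ne.symm hcd), if_pos rfl, zero_sub, LinearMap.zero_apply, Prod.smul_mk, smul_zero]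
      rw [Complex.ofReal_neg, Complex.ofReal_one, neg_one_smul]
    · rintro (e | e) hes het
      · rw [weilVec_inl, kOp_apply, map_zero, LinearMap.zero_apply, Prod.mk_zero_zero]
      · have hce : c ≠ e := fun h ↦ hes (by rw [h])
        have hde : d ≠ e := fun h ↦ het (by rw [h])
        rw [weilVec_inr, kOp_apply, LinearMap.sub_apply, munit_apply_basis, munit_apply_basis, if_neg hde,
          if_neg hce, sub_zero, LinearMap.zero_apply, Prod.mk_zero_zero]
    · exact adAlt_kOp_rot_snd_eq_zero b hγ c d

include b in
/-- **The bound with an auxiliary orthonormal basis**: `dim (tangent annihilator in degree k) ≤ 1` for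
`k ≠ 2 #ι`. [cite: vanGeemen1994HodgeAV, Thm. 6.12 and its proof] -/
theorem finrank_tangentAnnihilator_le_one_of_basis {k : ℕ} (hk : k ≠ 2 * Fintype.card ι) :
    Module.finrank ℂ (tangentAnnihilator (P := P) k) ≤ 1 :=
  finrank_le_one_of_torus_of_swaps (weilFrame_weilVec b) (sum_weilFrame_smulRight_weilVec b)
    (by rwa [Fintype.card_sum, ← two_mul]) _ (exists_torus_of_sum_eq_zero b k) (exists_swap b k)

include b in
/-- `dim (tangent annihilator) ≤ 3` in every degree, with an auxiliary orthonormal basis.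
[cite: vanGeemen1994HodgeAV, Thm. 6.12 and its proof] -/
theorem finrank_tangentAnnihilator_le_three_of_basis (k : ℕ) :
    Module.finrank ℂ (tangentAnnihilator (P := P) k) ≤ 3 :=
  finrank_le_three_of_torus_of_swaps (weilFrame_weilVec b) (sum_weilFrame_smulRight_weilVec b) _
    (exists_torus_of_sum_eq_zero b k) (exists_swap b k)

include b in
/-- The tangent annihilator vanishes in odd degrees `k ≠ 2 #ι`, with an auxiliary orthonormal basis.
[cite: vanGeemen1994HodgeAV, Thm. 6.12 and its proof] -/
theorem tangentAnnihilator_eq_bot_of_odd_of_basis {k : ℕ} (hk : k ≠ 2 * Fintype.card ι) (hodd : Odd k) :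
    tangentAnnihilator (P := P) k = ⊥ :=
  eq_bot_of_torus_of_odd (weilFrame_weilVec b) (sum_weilFrame_smulRight_weilVec b)
    (by rwa [Fintype.card_sum, ← two_mul]) hodd _ (exists_torus_of_sum_eq_zero b k)

end Witnesses

/-! ## §3 The bounds (van Geemen's Thm. 6.12 at the infinitesimal level, on the standard carrier) -/

/-- **`dim_ℂ {γ ∈ Alt^k_ℝ(U; ℂ) : ad(𝔭) γ = 0} ≤ 1` for `k ≠ 2 dim_ℂ P = dim_ℂ U`** — van Geemen's «`dim B^p(X) = 1` for
`p ≠ n`» at the infinitesimal level: a class staying of type `(p,p)` along the Weil family is, at the base point, in an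
at most one-dimensional space (spanned by `E^{∧p}`). [cite: vanGeemen1994HodgeAV, Thm. 6.12 and its proof (pp. 232–233)] -/
theorem finrank_tangentAnnihilator_le_one {k : ℕ} (hk : k ≠ 2 * finrank ℂ P) :
    Module.finrank ℂ (tangentAnnihilator (P := P) k) ≤ 1 :=
  finrank_tangentAnnihilator_le_one_of_basis (stdOrthonormalBasis ℂ P) (by rwa [Fintype.card_fin])

/-- **`dim_ℂ {γ ∈ Alt^k_ℝ(U; ℂ) : ad(𝔭) γ = 0} ≤ 3` in every degree** — van Geemen's «`dim B^n(X) = 3`» at the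
infinitesimal level (`E^{∧n}` and the two Weil–Hodge classes). [cite: vanGeemen1994HodgeAV, Thm. 6.12 and its proof (pp. 232–233)] -/
theorem finrank_tangentAnnihilator_le_three (k : ℕ) : Module.finrank ℂ (tangentAnnihilator (P := P) k) ≤ 3 :=
  finrank_tangentAnnihilator_le_three_of_basis (stdOrthonormalBasis ℂ P) k

/-- **No odd-degree invariants**: for odd `k ≠ 2 dim_ℂ P` the tangent annihilator is `0`.
[cite: vanGeemen1994HodgeAV, Thm. 6.12 and its proof] -/
theorem tangentAnnihilator_eq_bot_of_odd {k : ℕ} (hk : k ≠ 2 * finrank ℂ P) (hodd : Odd k) :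
    tangentAnnihilator (P := P) k = ⊥ :=
  tangentAnnihilator_eq_bot_of_odd_of_basis (stdOrthonormalBasis ℂ P) (by rwa [Fintype.card_fin]) hodd

end WeilFamily

end Literature.AlgebraicGeometry.HodgeTheory

end
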